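import Mathlib
import Literature.NumberTheory.Automorphic.IdeleClassCharacterConjugate

/-!
# STUB-IDEAS k3·g6 for `stub_heegnerIndexLowerAtTwo` (crux stmt-BirchSwinnertonDyer-27851,
# `PrintCf2.SplitBadTwoLowerHalfOfFacts`) — TECHNIQUE «decomposition (split into sub-stubs with a
# provable glue)» applied to the node **β = (W-e) `BalanceAtPhi`** of k3-g3's specialisation package
# (STUB-PLAN v1.7: inside T3 the critic ranks «Δ-branch > β > Γ-branch»; k3-g5 decomposed the
# Δ-branch, NOBODY has touched β).

LEVER («conjugate-pair symmetrisation»). k3-g3 runs the `𝔭`-adic triple (W-a) ERL ∧ (W-b)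
factorisation ∧ (W-c) in-range Katz for ONE good pair `π = (f₀, χ')` of the good partner and must then
split the Heegner multiplier `κ` (`z^W_δ = κ·P`) into `k = ord_(v,𝔓) κ` and `k̄ = ord_(v̄,𝔓̄) κ`:
Gross–Zagier (W-d) gives only `k + k̄`, so the BALANCE `β = k − k̄` is left as (W-e), «the one conjunct
with no printed shape» (research-S/M).  Run the SAME `𝔭`-adic triple a second time, on the
complex-conjugate pair `π' := c̃·π = (f̄₀ = f₀ ⊗ ε₀⁻¹, χ̄'∘c)`:
* `π'` is again a good pair FOR THE SAME `𝔭`-ADIC PROBLEM with the SAME two constituents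
  `{λ_W, μ̃}` — because each constituent of a self-dual pair is conjugate self-dual and a conjugate
  self-dual unitary character is FIXED by the diagonal action `ψ ↦ conj ∘ ψ ∘ c`
  (§D, PROVED from the tree's `isConjugateSelfDual_iff_galConj_eq_inv`) — so its (W-b) has the SAME
  member value `G0` and the SAME partner value exponent `a`;
* its Heegner multiplier is `κ(π') = ζ·c̃(κ(π))` (Aut(ℚ̄)-equivariance of CM points + Hecke
  projectors; X₀-prototype: Gross, Prop. 5.3 `y_n^τ = ε·y_n^{σ'} + torsion`, Castella–Hsieh 2018
  Lemma 4.6 `z_{f,χ,c}^τ = w_f·χ(σ_𝔑)·z_{f,χ⁻¹,c}^{σ_𝔑̄}`), hence `k(π') = ord_(v,𝔓) c̃κ = k̄(π)`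
  (§E: the value-level interface `TransportMultiplierAtPhi`, `k'_eq_kbar` PROVED from it).
ADDING the two `𝔭`-adic identities uses only `k + k̄` = (W-d):  **β never appears, `a` cancels**, and
T3's analytic table becomes `e_A = (ε + ε') − (ρ + ρ')/2 + 2g` — EXPLICIT in the four local digits of
the two pairs (§C `valueFormula_of_conjugatePairs`, PROVED).  SUBTRACTING them DERIVES (W-e):
`4β = 2(ε' − ε) − (ρ' − ρ)` (§C `balance_of_conjugatePairs`, PROVED) — a falsifiable PREDICTION for
the Heegner multiplier of every member.  The ONE-SIDED chain LOWER consumes (k3-g3 Plan 2 needed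
`LowerBalanceAtPhi β ≤ k − k̄`, «Birch-lemma flavour, no print») now needs NO balance statement at all:
§C `lower_of_conjugatePairs` (PROVED) from the one-sided triples of BOTH pairs + (W-d).

NOT the `𝔭̄`-adic chain: the conjugate BRANCH of the same pair is degenerate (its in-range factor is
`L(W,1) = 0`, its ERL sees the torsion `μ̃`-part), and the `𝔭̄`-adic chain of `W` itself is the
`𝔭`-adic chain transported (BCG⁺20 Lemma 3.3.2 (a) `𝓛_{𝔭̄,ψ} = σ(𝓛_{𝔭,ψ∘σ})`) — a tautology, as
k3-g3 §1.2 (W-e) correctly observed.  The new equation comes from a DIFFERENT PAIR at the SAME prime.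

HONEST FRAMING. Nothing here proves the stub, the crux, its parent or BSD — **BSD is NOT proved by any
of this**; no `L`-value and no `2`-adic `L`-function is computed.  What is kernel-checked is GLUE over
k3-g3's value-level `Prop`s (re-declared verbatim in §A so the critic can diff), one tree-level lemma
(§D) and the audit arithmetic of §F.  Sorries: NONE (the research inputs are HYPOTHESES of the glue
theorems, exactly as in k3-g3/k3-g5; the two research sub-stubs of this card are the Props
`TransportMultiplierAtPhi` (§E) and «(W-a)∧(W-b)∧(W-c) for π'», i.e. k3-g5's S1–S5 instantiated a
second time — no NEW research statement is introduced).
-/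

namespace Summit.BirchSwinnertonDyer.BirchSwinnertonDyer.Cruxes.SplitBadTwoLowerHalfOfFacts.HeegnerIndexTwo.K3G6

open Real

/-! ### §A  k3-g3's value-level currency, VERBATIM (Ideas/stub-heegnerindexloweratwo-k3-g3.md §1.3)
All valuations normalised as in S2′ (`‖x‖ = 2^{−val}`, `m/2 = ord G(0)`); `ℓ, q, t, τ` are S2′'s own
binders (`ord₂ log P`, `ord₂ Ш_an`-carrier, `ord₂ ∏c`, `ord₂ #tors`); `a` = exponent of the partner's
algebraic central value; `ε, ρ` the local digits of (W-a), (W-c); `g` the explicit Gross–Zagier digit. -/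

/-- (W-a) explicit reciprocity law specialised at `φ_δ`: `‖Lf‖ = 2^(−ε/2 − k − ℓ)`. -/
def ERLAtPhi (Lf : ℂ_[2]) (ε k ℓ : ℤ) : Prop := ‖Lf‖ = (2:ℝ) ^ (-(ε:ℝ)/2 - k - ℓ)
/-- (W-b) BDP/Katz factorisation specialised at `φ_δ`: `Lf² = u·G0·Lin`, `‖u‖ = 1`. -/
def FactorisationAtPhi (G0 Lf Lin : ℂ_[2]) : Prop := ∃ u : ℂ_[2], ‖u‖ = 1 ∧ Lf ^ 2 = u * G0 * Lin
/-- (W-c) Katz interpolation IN RANGE at the partner: `‖Lin‖ = 2^(−ρ/2 − a)`. -/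
def InRangeAtPhi (Lin : ℂ_[2]) (ρ a : ℤ) : Prop := ‖Lin‖ = (2:ℝ) ^ (-(ρ:ℝ)/2 - a)
/-- (W-d) explicit Gross–Zagier for the pair projected to `W`: `ord N(κ) = k + k̄ = g + q + t − 2τ + a`. -/
def ExplicitGZAtPhi (k kbar g q t τ a : ℤ) : Prop := k + kbar = g + q + t - 2 * τ + a
/-- (W-e) the `c`-balance of the Heegner multiplier (k3-g3: «the only conjunct with no printed shape»). -/
def BalanceAtPhi (k kbar β : ℤ) : Prop := k - kbar = β
/-- k3-g3 Plan 2: the one-sided balance LOWER was thought to need. -/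
def LowerBalanceAtPhi (k kbar β : ℤ) : Prop := β ≤ k - kbar

/-! One-sided forms (k3-g5 row «(W-a⁻), (W-b⁻)», direction audited there: `ord G0 ≥ 2·ord Lf − ord Lin`). -/

/-- (W-a⁻): `ord Lf ≥ ε/2 + k + ℓ`. -/
def ERLLowerAtPhi (Lf : ℂ_[2]) (ε k ℓ : ℤ) : Prop := ‖Lf‖ ≤ (2:ℝ) ^ (-(ε:ℝ)/2 - k - ℓ)
/-- (W-b⁻): `G0·Lin = w·Lf²` with `w` integral (divisibility, not factorisation). -/
def FactorisationLowerAtPhi (G0 Lf Lin : ℂ_[2]) : Prop :=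
  ∃ w : ℂ_[2], ‖w‖ ≤ 1 ∧ G0 * Lin = w * Lf ^ 2

/-! ### §B  Norm ↔ exponent bridges (base `2`, real exponents) -/

theorem two_rpow_inj {x y : ℝ} (h : (2:ℝ) ^ x = (2:ℝ) ^ y) : x = y :=
  le_antisymm ((Real.rpow_le_rpow_left_iff (by norm_num)).1 h.le)
    ((Real.rpow_le_rpow_left_iff (by norm_num)).1 h.ge)

theorem two_rpow_le_iff {x y : ℝ} : (2:ℝ) ^ x ≤ (2:ℝ) ^ y ↔ x ≤ y :=
  Real.rpow_le_rpow_left_iff (by norm_num)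

theorem two_rpow_sq (x : ℝ) : ((2:ℝ) ^ x) ^ 2 = (2:ℝ) ^ (2 * x) := by
  rw [← Real.rpow_natCast, ← Real.rpow_mul (by norm_num : (0:ℝ) ≤ 2)]
  norm_num [mul_comm]

theorem two_rpow_add (x y : ℝ) : (2:ℝ) ^ x * (2:ℝ) ^ y = (2:ℝ) ^ (x + y) :=
  (Real.rpow_add (by norm_num : (0:ℝ) < 2) x y).symm

/-- From an exact factorisation and the three norms, the exponent identity `2x = y + z`. -/
theorem exp_eq_of_factorisation {G0 Lf Lin : ℂ_[2]} {x y z : ℝ}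
    (hB : FactorisationAtPhi G0 Lf Lin) (hLf : ‖Lf‖ = (2:ℝ) ^ x) (hG : ‖G0‖ = (2:ℝ) ^ y)
    (hLin : ‖Lin‖ = (2:ℝ) ^ z) : 2 * x = y + z := by
  obtain ⟨u, hu, hfac⟩ := hB
  have h1 : ‖Lf‖ ^ 2 = ‖G0‖ * ‖Lin‖ := by
    rw [← norm_pow, hfac, norm_mul, norm_mul, hu, one_mul]
  rw [hLf, hG, hLin, two_rpow_sq, two_rpow_add] at h1
  exact two_rpow_inj h1

/-- From a one-sided factorisation (divisibility) and a one-sided ERL, the exponent INEQUALITY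
`y + z ≤ 2x` (i.e. `ord G0 ≥ 2·ord Lf − ord Lin`; k3-g5's audited direction). -/
theorem exp_le_of_factorisationLower {G0 Lf Lin : ℂ_[2]} {x y z : ℝ}
    (hB : FactorisationLowerAtPhi G0 Lf Lin) (hLf : ‖Lf‖ ≤ (2:ℝ) ^ x) (hG : ‖G0‖ = (2:ℝ) ^ y)
    (hLin : ‖Lin‖ = (2:ℝ) ^ z) : y + z ≤ 2 * x := by
  obtain ⟨w, hw, hfac⟩ := hB
  have h1 : ‖G0‖ * ‖Lin‖ ≤ ‖Lf‖ ^ 2 := by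
    rw [← norm_mul, hfac, norm_mul, norm_pow]
    calc ‖w‖ * ‖Lf‖ ^ 2 ≤ 1 * ‖Lf‖ ^ 2 := by gcongr
      _ = ‖Lf‖ ^ 2 := one_mul _
  have h2 : ‖Lf‖ ^ 2 ≤ ((2:ℝ) ^ x) ^ 2 := by gcongr
  have h3 : (2:ℝ) ^ (y + z) ≤ (2:ℝ) ^ (2 * x) := by
    rw [← two_rpow_add, ← two_rpow_sq, ← hG, ← hLin]; exact h1.trans h2
  exact two_rpow_le_iff.1 h3

/-! ### §C  THE GLUE (PROVED): one pair, two conjugate pairs (β-free), the derived balance, LOWER -/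

section Glue

variable {G0 Lf Lin Lf' Lin' : ℂ_[2]} {ε ρ ε' ρ' k k' kbar ℓ a g q t τ : ℤ}

/-- ONE pair (k3-g3's intermediate step, re-derived): `m = 2ε + 4k + 4ℓ − ρ − 2a`. -/
theorem valueFormula_onePair (hA : ERLAtPhi Lf ε k ℓ) (hB : FactorisationAtPhi G0 Lf Lin)
    (hC : InRangeAtPhi Lin ρ a) :
    ∀ m : ℤ, ‖G0‖ = (2:ℝ) ^ (-(m:ℝ)/2) → m = 2 * ε + 4 * k + 4 * ℓ - ρ - 2 * a := by
  intro m hm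
  have h := exp_eq_of_factorisation hB hA hm hC
  have : (m:ℝ) = 2 * ε + 4 * k + 4 * ℓ - ρ - 2 * a := by linarith
  exact_mod_cast this

/-- **TOP (β-FREE VALUE FORMULA).** The `𝔭`-adic triple for the pair `π` AND for its complex
conjugate `π' = c̃·π` (same `G0`, same partner exponent `a`, same `ℓ`), the transport `k' = k̄`
(§E) and explicit Gross–Zagier (W-d) give S2′'s exponent with an EXPLICIT table and NO balance term:
`2m = 4(q + t − 2τ + 2ℓ) + [2(ε + ε') − (ρ + ρ') + 4g]`. -/
theorem valueFormula_of_conjugatePairs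
    (hA : ERLAtPhi Lf ε k ℓ) (hB : FactorisationAtPhi G0 Lf Lin) (hC : InRangeAtPhi Lin ρ a)
    (hA' : ERLAtPhi Lf' ε' k' ℓ) (hB' : FactorisationAtPhi G0 Lf' Lin') (hC' : InRangeAtPhi Lin' ρ' a)
    (hT : k' = kbar) (hD : ExplicitGZAtPhi k kbar g q t τ a) :
    ∀ m : ℤ, ‖G0‖ = (2:ℝ) ^ (-(m:ℝ)/2) →
      2 * m = 4 * (q + t - 2 * τ + 2 * ℓ) + (2 * (ε + ε') - (ρ + ρ') + 4 * g) := by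
  intro m hm
  have h1 := valueFormula_onePair hA hB hC m hm
  have h2 := valueFormula_onePair hA' hB' hC' m hm
  unfold ExplicitGZAtPhi at hD
  omega

/-- **(W-e) DERIVED, with an explicit balance.** Subtracting the two one-pair identities:
`4(k − k') = 2(ε' − ε) − (ρ' − ρ)`; with `k' = k̄` this IS `BalanceAtPhi k k̄ β` for the explicit
`β = [2(ε' − ε) − (ρ' − ρ)]/4` — a PREDICTION (cheapest falsifier of the card). -/
theorem balance_of_conjugatePairs
    (hA : ERLAtPhi Lf ε k ℓ) (hB : FactorisationAtPhi G0 Lf Lin) (hC : InRangeAtPhi Lin ρ a)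
    (hA' : ERLAtPhi Lf' ε' k' ℓ) (hB' : FactorisationAtPhi G0 Lf' Lin') (hC' : InRangeAtPhi Lin' ρ' a) :
    ∀ m : ℤ, ‖G0‖ = (2:ℝ) ^ (-(m:ℝ)/2) → 4 * (k - k') = 2 * (ε' - ε) - (ρ' - ρ) := by
  intro m hm
  have h1 := valueFormula_onePair hA hB hC m hm
  have h2 := valueFormula_onePair hA' hB' hC' m hm
  omega

/-- Corollary: k3-g3's (W-e) holds with the explicit `β`, whenever `4 ∣ 2(ε' − ε) − (ρ' − ρ)`
(forced: the left side is `4(k − k̄)`). -/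
theorem balanceAtPhi_of_conjugatePairs
    (hA : ERLAtPhi Lf ε k ℓ) (hB : FactorisationAtPhi G0 Lf Lin) (hC : InRangeAtPhi Lin ρ a)
    (hA' : ERLAtPhi Lf' ε' k' ℓ) (hB' : FactorisationAtPhi G0 Lf' Lin') (hC' : InRangeAtPhi Lin' ρ' a)
    (hT : k' = kbar) {m : ℤ} (hm : ‖G0‖ = (2:ℝ) ^ (-(m:ℝ)/2)) {β : ℤ}
    (hβ : 4 * β = 2 * (ε' - ε) - (ρ' - ρ)) : BalanceAtPhi k kbar β := by
  have h := balance_of_conjugatePairs hA hB hC hA' hB' hC' m hm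
  unfold BalanceAtPhi; omega

/-- Consistency with k3-g3 §1.3: the TOP formula is k3-g3's `m = 2(q+t−2τ+2ℓ) + (2ε − ρ + 2g + 2β)`
with the derived `β`. -/
theorem k3g3_formula_recovered
    (hA : ERLAtPhi Lf ε k ℓ) (hB : FactorisationAtPhi G0 Lf Lin) (hC : InRangeAtPhi Lin ρ a)
    (hD : ExplicitGZAtPhi k kbar g q t τ a) {m β : ℤ}
    (hm : ‖G0‖ = (2:ℝ) ^ (-(m:ℝ)/2)) (hβ : BalanceAtPhi k kbar β) :
    m = 2 * (q + t - 2 * τ + 2 * ℓ) + (2 * ε - ρ + 2 * g + 2 * β) := by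
  have h1 := valueFormula_onePair hA hB hC m hm
  unfold ExplicitGZAtPhi at hD; unfold BalanceAtPhi at hβ
  omega

/-- **PARITY CONSTRAINT (free falsifier).** Each one-pair identity gives `m ≡ ρ (mod 2)`; so the
in-range digits of the two conjugate pairs have EQUAL PARITY, and the derived `4β` is automatically
`≡ 2(ε' − ε) (mod 2)`-consistent.  A parity mismatch in a computed table kills (W-b)/(W-c) as typed. -/
theorem parity_of_conjugatePairs
    (hA : ERLAtPhi Lf ε k ℓ) (hB : FactorisationAtPhi G0 Lf Lin) (hC : InRangeAtPhi Lin ρ a)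
    (hA' : ERLAtPhi Lf' ε' k' ℓ) (hB' : FactorisationAtPhi G0 Lf' Lin') (hC' : InRangeAtPhi Lin' ρ' a) :
    ∀ m : ℤ, ‖G0‖ = (2:ℝ) ^ (-(m:ℝ)/2) → ρ % 2 = ρ' % 2 ∧ m % 2 = ρ % 2 := by
  intro m hm
  have h1 := valueFormula_onePair hA hB hC m hm
  have h2 := valueFormula_onePair hA' hB' hC' m hm
  omega

/-- **WHAT LOWER CONSUMES (one-sided, balance-free).** From the ONE-SIDED triples of both pairs
((W-a⁻), (W-b⁻) and the exact in-range (W-c)), the transport and (W-d):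
`2m ≥ 4(q + t − 2τ + 2ℓ) + [2(ε + ε') − (ρ + ρ') + 4g]` — k3-g3's `RubinValueLowerTwo` slot with
`e_A := (ε + ε') − (ρ + ρ')/2 + 2g`, and NO `LowerBalanceAtPhi`. -/
theorem lower_of_conjugatePairs
    (hA : ERLLowerAtPhi Lf ε k ℓ) (hB : FactorisationLowerAtPhi G0 Lf Lin) (hC : InRangeAtPhi Lin ρ a)
    (hA' : ERLLowerAtPhi Lf' ε' k' ℓ) (hB' : FactorisationLowerAtPhi G0 Lf' Lin')
    (hC' : InRangeAtPhi Lin' ρ' a) (hT : k' = kbar) (hD : ExplicitGZAtPhi k kbar g q t τ a) :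
    ∀ m : ℤ, ‖G0‖ = (2:ℝ) ^ (-(m:ℝ)/2) →
      4 * (q + t - 2 * τ + 2 * ℓ) + (2 * (ε + ε') - (ρ + ρ') + 4 * g) ≤ 2 * m := by
  intro m hm
  have h1 := exp_le_of_factorisationLower hB hA hm hC
  have h2 := exp_le_of_factorisationLower hB' hA' hm hC'
  unfold ExplicitGZAtPhi at hD
  have h3 : (4 * (q + t - 2 * τ + 2 * ℓ) + (2 * (ε + ε') - (ρ + ρ') + 4 * g) : ℝ) ≤ 2 * m := by
    have hD' : (k:ℝ) + kbar = g + q + t - 2 * τ + a := by exact_mod_cast hD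
    have hT' : (k':ℝ) = kbar := by exact_mod_cast hT
    linarith
  exact_mod_cast h3

/-- Even (W-d) is consumed one-sidedly: `k + k̄ ≥ g + q + t − 2τ + a` suffices for LOWER. -/
theorem lower_of_conjugatePairs_oneSidedGZ
    (hA : ERLLowerAtPhi Lf ε k ℓ) (hB : FactorisationLowerAtPhi G0 Lf Lin) (hC : InRangeAtPhi Lin ρ a)
    (hA' : ERLLowerAtPhi Lf' ε' k' ℓ) (hB' : FactorisationLowerAtPhi G0 Lf' Lin')
    (hC' : InRangeAtPhi Lin' ρ' a) (hT : k' = kbar) (hD : g + q + t - 2 * τ + a ≤ k + kbar) :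
    ∀ m : ℤ, ‖G0‖ = (2:ℝ) ^ (-(m:ℝ)/2) →
      4 * (q + t - 2 * τ + 2 * ℓ) + (2 * (ε + ε') - (ρ + ρ') + 4 * g) ≤ 2 * m := by
  intro m hm
  have h1 := exp_le_of_factorisationLower hB hA hm hC
  have h2 := exp_le_of_factorisationLower hB' hA' hm hC'
  have h3 : (4 * (q + t - 2 * τ + 2 * ℓ) + (2 * (ε + ε') - (ρ + ρ') + 4 * g) : ℝ) ≤ 2 * m := by
    have hD' : (g:ℝ) + q + t - 2 * τ + a ≤ k + kbar := by exact_mod_cast hD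
    have hT' : (k':ℝ) = kbar := by exact_mod_cast hT
    linarith
  exact_mod_cast h3

/-- The same in k3-g3's consumption shape (B1 direction audit: LOWER uses S2′ only as
`2·(ord₂q + t − 2τ + 2ℓ) + e_A ≤ m`): with the EXPLICIT table `e_A` defined by
`2·e_A = 2(ε + ε') − (ρ + ρ') + 4g` (an integer by `parity_of_conjugatePairs`). -/
theorem lowerSlot_of_conjugatePairs
    (hA : ERLLowerAtPhi Lf ε k ℓ) (hB : FactorisationLowerAtPhi G0 Lf Lin) (hC : InRangeAtPhi Lin ρ a)
    (hA' : ERLLowerAtPhi Lf' ε' k' ℓ) (hB' : FactorisationLowerAtPhi G0 Lf' Lin')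
    (hC' : InRangeAtPhi Lin' ρ' a) (hT : k' = kbar) (hD : ExplicitGZAtPhi k kbar g q t τ a)
    {eA : ℤ} (hE : 2 * eA = 2 * (ε + ε') - (ρ + ρ') + 4 * g) :
    ∀ m : ℤ, ‖G0‖ = (2:ℝ) ^ (-(m:ℝ)/2) → 2 * (q + t - 2 * τ + 2 * ℓ) + eA ≤ m := by
  intro m hm
  have h := lower_of_conjugatePairs hA hB hC hA' hB' hC' hT hD m hm
  omega

/-- The exact factorisation implies the one-sided one; the exact ERL implies the one-sided one. -/
theorem factorisationLower_of_factorisation (h : FactorisationAtPhi G0 Lf Lin) :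
    FactorisationLowerAtPhi G0 Lf Lin := by
  obtain ⟨u, hu, hfac⟩ := h
  have hu0 : u ≠ 0 := by
    intro h0; rw [h0, norm_zero] at hu; exact zero_ne_one hu
  refine ⟨u⁻¹, by rw [norm_inv, hu, inv_one], ?_⟩
  rw [hfac]; field_simp

theorem erlLower_of_erl (h : ERLAtPhi Lf ε k ℓ) : ERLLowerAtPhi Lf ε k ℓ := le_of_eq h

/-! NORMALISATION SHIFTS (why «same `G0`» costs nothing).  By transport of structure the conjugate
pair's out-of-range Katz value is `Katz^{(ι,Σ_v)}(λ_W; c•S)` where `S` is the tame depletion of the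
normalisation in use: it IS `G0` when `S` is `c`-stable (the primitive, character-attached
normalisation: `𝔣_{λ_W}` is `c`-invariant because `λ_W` is self-dual, BCST22 §8), and `R·G0` with
`R` an explicit Euler-factor ratio otherwise.  Either way the glue above applies verbatim: `R` is
pushed into `Lin'` (so `ρ'` carries the digit `2·ord R`). -/

/-- A factorisation against `R·G0` is a factorisation against `G0` with `R` moved into `Lin'`. -/
theorem factorisation_absorb {R : ℂ_[2]} (h : FactorisationAtPhi (R * G0) Lf' Lin') :
    FactorisationAtPhi G0 Lf' (R * Lin') := by
  obtain ⟨u, hu, hfac⟩ := h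
  exact ⟨u, hu, by rw [hfac]; ring⟩

theorem factorisationLower_absorb {R : ℂ_[2]} (h : FactorisationLowerAtPhi (R * G0) Lf' Lin') :
    FactorisationLowerAtPhi G0 Lf' (R * Lin') := by
  obtain ⟨w, hw, hfac⟩ := h
  exact ⟨w, hw, by rw [← hfac]; ring⟩

/-- … and the in-range digit shifts by `2r` when `‖R‖ = 2^{−r}` (`r ∈ ½ℤ` allowed as a real). -/
theorem inRange_shift {R : ℂ_[2]} {r : ℝ} {ρ'' : ℤ} (h : InRangeAtPhi Lin' ρ' a)
    (hR : ‖R‖ = (2:ℝ) ^ (-r)) (hρ : (ρ'':ℝ) = ρ' + 2 * r) : InRangeAtPhi (R * Lin') ρ'' a := by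
  unfold InRangeAtPhi at h ⊢
  rw [norm_mul, hR, h, two_rpow_add, hρ]
  congr 1; ring

end Glue

/-! ### §D  WHY `π' = c̃·π` HAS THE SAME CONSTITUENTS (tree-level, PROVED).
The diagonal action of complex conjugation on a unitary idele class character of a CM field —
conjugate the ARGUMENT (`galConj c`, the tree's `μ^c = μ ∘ c`, [Liu2021] §4.1) AND the VALUE
(inversion on `S¹` = complex conjugation) — FIXES every conjugate self-dual character
([Liu2021] Def. 4.1; tree `isConjugateSelfDual_iff_galConj_eq_inv`).  Both constituents `λ_W = ψ₀χ'`,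
`μ̃ = ψ₀^cχ'` of a good pair are conjugate self-dual (`ψ₀ψ₀^c = (ε₀∘N)·N`, `χ'χ'^c = ε₀⁻¹∘N` by the
central-character condition `ε₀·χ|_{𝔸_ℚ^×} = 1` of BCST22 §8 / BDP12), and the constituents of
`c̃·π = (f₀ ⊗ ε₀⁻¹, χ̄'∘c)` are the diagonal conjugates of those of `π`; so `{λ_W, μ̃}` is unchanged:
`π'` is a good pair for the SAME member `W` at the SAME prime `v`, with the W-constituent on the same
(out-of-range) side — the reason (W-b) for `π'` carries the SAME `G0` and (W-c) the same `a`. -/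

section Constituents

open NumberField Literature.NumberTheory.Automorphic

variable {L : Type} [Field L] [NumberField L] [IsCMField L]

/-- The diagonal conjugate `conj ∘ ψ ∘ c` of a unitary idele class character equals `ψ` when `ψ` is
conjugate self-dual (pointwise; inversion on `Circle` is complex conjugation). -/
theorem diagConj_apply_eq_self (ψ : IdeleClassGroup L →ₜ* Circle)
    (h : IdeleClassGroup.IsConjugateSelfDual L ψ) (x : IdeleClassGroup L) :
    (IdeleClassGroup.galConj (IsCMField.complexConj L) ψ x)⁻¹ = ψ x := by
  rw [(IdeleClassGroup.isConjugateSelfDual_iff_galConj_eq_inv ψ).1 h x, inv_inv]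

/-- The same, read in `ℂ`: `conj (ψ(c • x)) = ψ x`. -/
theorem conj_galConj_apply_eq_self (ψ : IdeleClassGroup L →ₜ* Circle)
    (h : IdeleClassGroup.IsConjugateSelfDual L ψ) (x : IdeleClassGroup L) :
    starRingEnd ℂ ((IdeleClassGroup.galConj (IsCMField.complexConj L) ψ x : Circle) : ℂ) = (ψ x : ℂ) := by
  rw [← Circle.coe_inv_eq_conj, diagConj_apply_eq_self ψ h x]

/-- Conversely the diagonal action fixes ONLY conjugate self-dual characters: the fixed-point
condition is EQUIVALENT to conjugate self-duality (so the lever uses exactly BCST's «λ self-dual»). -/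
theorem diagConj_eq_self_iff (ψ : IdeleClassGroup L →ₜ* Circle) :
    (∀ x, (IdeleClassGroup.galConj (IsCMField.complexConj L) ψ x)⁻¹ = ψ x) ↔
      IdeleClassGroup.IsConjugateSelfDual L ψ := by
  rw [IdeleClassGroup.isConjugateSelfDual_iff_galConj_eq_inv]
  exact forall_congr' fun x => ⟨fun h => by rw [← h, inv_inv], fun h => by rw [h, inv_inv]⟩

end Constituents

/-! ### §E  THE TRANSPORT SUB-STUB (value-level interface; the geometric content is Aut(ℚ̄)-
equivariance of the generalised Heegner class and of the `W`-projector: `z^W(c̃·π) = c̃(z^W(π))`,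
`c(P) = P` for the rational generator, hence `κ(π') = ζ·c̃(κ(π))` with `ζ` a root of unity /
Atkin–Lehner pseudo-eigenvalue of `2`-adic norm `1` (level `N₀` odd).  Prototype in print:
Gross Prop. 5.3, Castella–Hsieh 2018 Lemma 4.6.)  `κv'` = image of `κ(π')` at `(v, 𝔓)`;
`κvbar` = image of `κ(π)` at `(v̄, 𝔓̄)` = image of `c̃κ(π)` at `(v, 𝔓)` (tautology of transport). -/

/-- Transport of the Heegner multiplier under the conjugate-pair involution (research-free in print,
UNTYPED in the tree: sub-stub T of this card). -/
def TransportMultiplierAtPhi (κv' κvbar : ℂ_[2]) : Prop := ∃ ζ : ℂ_[2], ‖ζ‖ = 1 ∧ κv' = ζ * κvbar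

/-- From the transport, the exponents agree: `k(π') = k̄(π)` — the hypothesis `hT` of §C. -/
theorem k'_eq_kbar {κv' κvbar : ℂ_[2]} {k' kbar : ℤ} (h : TransportMultiplierAtPhi κv' κvbar)
    (h1 : ‖κv'‖ = (2:ℝ) ^ (-(k':ℝ))) (h2 : ‖κvbar‖ = (2:ℝ) ^ (-(kbar:ℝ))) : k' = kbar := by
  obtain ⟨ζ, hζ, hκ⟩ := h
  have : ‖κv'‖ = ‖κvbar‖ := by rw [hκ, norm_mul, hζ, one_mul]
  rw [h1, h2] at this
  have := two_rpow_inj this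
  have : (k':ℝ) = kbar := by linarith
  exact_mod_cast this

/-! ### §F  AUDIT ARITHMETIC for the price «P-match» (k3-g5 S5 `IsUnit w`, k3-g3 (W-b) `‖u‖ = 1`):
at `p = 2` an IMPRIMITIVE Euler factor `1 − u` (`u` a `v`-adic unit, e.g. `λ_W(𝔩)` or `±λ_W(𝔩̄)/N𝔩`
at an auxiliary prime `𝔩 ∣ N₀·c` where `λ_W` is unramified) is NEVER a unit — the residue field at a
split prime above `2` is `𝔽₂` — and of the two signs exactly one has valuation `1`.  So IF the
factorisation of record compares branches of different tame moduli, the comparison constants carry a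
digit `ι(π, d) ≥ #{auxiliary primes}` that depends on `d` through the signs `χ_d(ℓ)`, not only on
`d mod 8`; the two-pair glue above is agnostic (it books whatever `ε, ρ, ε', ρ'` are), but a KEY-table
claim must choose the pair menu (W-0) accordingly.  Integer shadows: -/

theorem imprimitiveFactor_even (u : ℤ) (hu : Odd u) : Even (1 - u) := by
  obtain ⟨r, hr⟩ := hu; exact ⟨-r, by omega⟩

/-- Exactly one of `1 − u`, `1 + u` is `2 mod 4` for odd `u`: the digit depends on the SIGN. -/
theorem imprimitiveFactor_sign_dichotomy (u : ℤ) (hu : Odd u) :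
    ((1 - u) % 4 = 2 ∧ (1 + u) % 4 = 0) ∨ ((1 - u) % 4 = 0 ∧ (1 + u) % 4 = 2) := by
  obtain ⟨r, hr⟩ := hu; omega

/-! ### §G  Sanity instances of the glue (degenerate numerics only; they show the identities are not
vacuous and fix the sign conventions). -/

example : ExplicitGZAtPhi 3 1 0 2 1 0 1 := by unfold ExplicitGZAtPhi; norm_num
example : BalanceAtPhi 3 1 2 := by unfold BalanceAtPhi; norm_num
example (k k' ε ε' ρ ρ' : ℤ) (h : 4 * (k - k') = 2 * (ε' - ε) - (ρ' - ρ)) (hε : ε = ε') (hρ : ρ = ρ') :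
    k = k' := by omega   -- symmetric digits ⇒ the multiplier is BALANCED (β = 0)

end Summit.BirchSwinnertonDyer.BirchSwinnertonDyer.Cruxes.SplitBadTwoLowerHalfOfFacts.HeegnerIndexTwo.K3G6
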